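import Literature.NumberTheory.Automorphic.UnitaryGroupLineRegularTwistTwo
import Literature.NumberTheory.Automorphic.UnitaryGroupKernelBorelClassHomogeneityTwo
import Literature.NumberTheory.Automorphic.UnitaryGroupKernelBorelClassHomogeneity
import Literature.NumberTheory.Automorphic.IdeleModuleProofs
import HarnessLib

/-!
# Unfolding the class Borel LATTICE SUM over `N(F)\N(𝔸_F)` for an `N`-regular class of `U(J₂)` (H-side copy at `N = 2`):
# `∫_{N(F)\N(𝔸)} Σ_{β ∈ B(F)∩𝔬̲} ψ(n⁻¹βn) dn = Σ_{t ∈ T(F)∩𝔬̲} ∫_{N(𝔸)} ψ(t u) du`, hence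
# `∫_{N(F)\N(𝔸)} (K_{B,𝔬}(n,n) − Σ_{β ∈ B(F)∩𝔬̲} ψ(n⁻¹βn)) dn = 0`
(Arthur, *A trace formula for reductive groups I*, Duke Math. J. 45 (1978), §8 — for an unramified class the
`N(F)`-conjugacy classes in `γN(F)` are parametrised by `N(F)` itself and `n ↦ γ⁻¹n⁻¹γn` has global Jacobian
`1`; Rogawski, *Automorphic Representations of Unitary Groups in Three Variables* (1990), §2.2 p. 13
(`K_{P,𝔬}`), §6.1 pp. 79–81, §7.3 p. 97 (the change of variables on `N`); Gelbart, *Automorphic forms on adele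
groups* (1975), §9.B)

Topic `NumberTheory/Automorphic`; namespace `Literature.NumberTheory.Automorphic.UnitaryGroup`. THEOREMS ONLY over
accepted tree modules: no definition, no named fact, no instance, no notation, no `sorry`. **(W2-b)_two FILE 2, part 2 (§§4–5)** —
the `N = 2` twin of ★ `UnitaryGroupBorelClassLatticeSumUnfolding` §§4–5 (§§1–3, the twist and its Jacobian, are
★ `UnitaryGroupLineRegularTwistTwo` (F0P3a-p02 (g7))) (item (L5-ii) of the T1-qs LAW 5 road,
`Cruxes/H413/Lines/F0_T1InnerFormTraceIdentity.lean`, cell `pub/hodgecm-mathlib`, crux H413; H-side copy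
`CENSUS-LAWS-Hside` §3, desk TABLE #2 (1): the trilogy consumed by the (σ-h) regular-hyperbolic CM closer). The heart of
«`∫ R_T dμ = 0`»: with `D_𝔬(y) := K_{B,𝔬}(y,y) − Σ_{β ∈ B(F)∩𝔬̲} f(y⁻¹βy)` («adelic `N`-average minus
`B(F)∩𝔬̲`-lattice sum»), the `N(F)\N(𝔸_F)`-average of `D_𝔬` VANISHES at every point — PROVIDED every rational torus
point of the class is `N`-REGULAR (`d₀ ≠ d₁`: the one root of `T` in `N` is non-trivial on it; equivalently
`d₀ c(d₀) ≠ 1`, the class is regular HYPERBOLIC — `ne_iff_conj_mul_ne_one_two`). For the central classes `(X − z)²`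
this fails (Rogawski (1990), Prop. 7.3.1), so the hypothesis `hreg` below is carried, in the idelic letters of ★ `diagUnit`:

  `hreg : ∀ β : B(F), cl β = 𝔬 → diagUnit β 0 ≠ diagUnit β 1`.

WHAT CHANGES AT `N = 2` (versus the `U(J₃)` file): `N(𝔸_F) ≅ 𝔸_E⁻` is the ABELIAN line (★ `UnitaryGroupLineUnipotentTwo`,
chart `b ↦ n(b)`), so the twist `η ↦ t⁻¹η⁻¹tη` is ONE root step (★ `exists_unipotent_conj_eq_diagonal_two`) and in the
coordinate it is the multiplication `b ↦ (1 − d₀⁻¹d₁) b` by a `c`-fixed scalar (★ `torusConj_middleRootUnipotent_two`);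
for a rational `N`-regular `t` that scalar is the principal idèle `(1 − τ₀⁻¹τ₁)_𝔸`, of module `1` on `𝔸_E⁻` by the
product formula (★ `traceZeroModulus_eq_one_of_principal`) — no Heisenberg commutator, no second root.

* §§1–3 (rational torus points, twist bijection, Jacobian one): ★ `UnitaryGroupLineRegularTwistTwo` (F0P3a-p02 (g7)).
* §4 **`setIntegral_borelSumClass_diag_eq_tsum_integral_two`** — THE UNFOLDING: for a class map constant along `N(F)` on
  `B(F)` whose class `𝔬` is `N`-regular, a Haar measure `ν` of `N(𝔸_F)`, a fundamental domain `Ω` of `N(F)` and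
  `ψ ∈ C_c(G(𝔸_F))`: `∫_Ω Σ_{β ∈ B(F)∩𝔬̲} ψ(n⁻¹βn) dν(n) = Σ'_{t ∈ T(F)∩𝔬̲} ∫_{N(𝔸)} ψ(t u) dν(u)`
  (cells ★ `exists_equiv_borelClassCell_prod`, §2 per `t`, unfolding ★ `setIntegral_tsum_prod_smul_eq_tsum_integral`, §3);
  `integrableOn_borelSumClass_diag_two`.
* §5 **`setIntegral_kernelBorelClass_diag_sub_borelSumClass_diag_eq_zero_two`** — `∫_Ω (K_{B,𝔬}(n,n) − Σ_{B(F)∩𝔬̲} ψ(n⁻¹βn)) dν(n) = 0`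
  (★ `kernelBorelClass_diag_eq_smul_tsum_integral`, ★ `kernelBorelClass_diag_borel_mul_two`, `ν(Ω) = ν(𝓕)`), and its
  translate **`setIntegral_kernelBorelClass_sub_borelSumClass_translate_eq_zero_two`**: `∫_Ω D_𝔬(n g₀) dν(n) = 0` for
  every `g₀ ∈ G(𝔸_F)` — the input of (W2-b)_two FILE 3 after unfolding ∕ Iwasawa.

HONEST LABEL: no printed statement is consumed; HC_CM is proved only modulo the printed citations until rung 0
closes.

## References

* J. Arthur, *A trace formula for reductive groups I: terms associated to classes in `G(ℚ)`*, Duke Math. J. 45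
  (1978), §8 [Arthur1978TraceFormulaI].
* J. D. Rogawski, *Automorphic Representations of Unitary Groups in Three Variables*, Annals of Mathematics
  Studies 123 (1990), §2.2 (p. 13), §6.1 (pp. 79–81), §7.3 (p. 97) [Rogawski1990].
* S. Gelbart, *Automorphic forms on adele groups*, Annals of Mathematics Studies 83 (1975), §9.B [Gelbart1975].
* J. Tate, *Fourier analysis in number fields and Hecke's zeta-functions* (1967), Thm. 4.3.1 [TateThesis1967].
-/

set_option autoImplicit false

noncomputable section

open MeasureTheory Measure NumberField IsDedekindDomain Set Matrix
open scoped NNReal ENNReal MatrixGroups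

namespace Literature.NumberTheory.Automorphic

namespace UnitaryGroup

variable {F E : Type} [Field F] [NumberField F] [Field E] [NumberField E] [Algebra F E]
  {c : E ≃ₐ[F] E} {ι : Type*}

/-! ## §0 Plumbing -/

/-- `N(F)` and `T(F)` are countable (they inject into the countable `G(F)`; private plumbing, as in ★
`UnitaryGroupKernelBorelTorusFibration`). [folklore] -/
private theorem countable_rationalUnipotent_rationalTorus₂₃w {N : ℕ} :
    Countable (rationalUnipotent F E c N) ∧ Countable (rationalTorus F E c N) := by
  haveI : Countable (quasiSplit F E c N).arithmeticSubgroup := by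
    haveI : Countable E := NumberField.countable' (K := E)
    haveI : Countable (Matrix (Fin N) (Fin N) E) := inferInstanceAs (Countable (Fin N → Fin N → E))
    haveI : Countable (GL (Fin N) E) := Units.val_injective.countable
    haveI : Countable (quasiSplit F E c N).Rational :=
      inferInstanceAs (Countable (rational F E c N ((StdForm.antidiagonal N).over E)))
    exact (Set.countable_range _).to_subtype
  have h1 : Function.Injective fun γ : rationalUnipotent F E c N =>
      (⟨((γ : adelicUnipotent F E c N) : (quasiSplit F E c N).Adelic), γ.2⟩ :
        (quasiSplit F E c N).arithmeticSubgroup) := fun a a' h =>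
    Subtype.ext (Subtype.ext (congrArg
      (fun z : (quasiSplit F E c N).arithmeticSubgroup => (z : (quasiSplit F E c N).Adelic)) h))
  have h2 : Function.Injective fun t : rationalTorus F E c N =>
      (⟨((t : torusAdelic F E c N) : (quasiSplit F E c N).Adelic), t.2⟩ :
        (quasiSplit F E c N).arithmeticSubgroup) := fun a a' h =>
    Subtype.ext (Subtype.ext (congrArg
      (fun z : (quasiSplit F E c N).arithmeticSubgroup => (z : (quasiSplit F E c N).Adelic)) h))
  exact ⟨h1.countable, h2.countable⟩


/-! ## §4 THE UNFOLDING of the class Borel lattice sum over `N(F)\N(𝔸_F)` -/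

section Unfold

variable [MeasurableSpace (adelicUnipotent F E c 2)] [BorelSpace (adelicUnipotent F E c 2)]

/-- **The fibration of the class Borel lattice sum** (private packaging of the data of §4): for an `N`-regular
class there is a family `Ψ_t(u) = ψ(u⁻¹ t u)` on `N(𝔸_F)`, indexed by the rational torus points `t` of the class,
with `Σ_{β ∈ B(F)∩𝔬̲} ψ(n⁻¹βn) = Σ_{(t,η) ∈ (T(F)∩𝔬̲) × N(F)} Ψ_t(η n)` pointwise, each `Ψ_t` integrable, finite total
mass, and `∫ Ψ_t = ∫ ψ(t u) du` (§2 + §3). [cite: Arthur1978TraceFormulaI, §8] [cite: Rogawski1990, §7.3 (p. 97)] -/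
private theorem exists_latticeSum_fibration (hc : c * c = 1) (hc1 : c ≠ 1)
    {cl : (quasiSplit F E c 2).arithmeticSubgroup → ι} (hclN : IsUnipotentInvariantOnBorel F E c 2 cl) (i : ι)
    (hreg : ∀ β : arithmeticBorel F E c 2, cl β = i →
      diagUnit ((mem_arithmeticBorel_iff _).1 β.2) 0 ≠ diagUnit ((mem_arithmeticBorel_iff _).1 β.2) 1)
    (ν : Measure (adelicUnipotent F E c 2)) [ν.IsHaarMeasure]
    {ψ : (quasiSplit F E c 2).Adelic → ℂ} (hψc : Continuous ψ) (hψ : HasCompactSupport ψ) :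
    ∃ Ψ : {t : rationalTorus F E c 2 //
        cl ⟨((t : torusAdelic F E c 2) : (quasiSplit F E c 2).Adelic), t.2⟩ = i} → adelicUnipotent F E c 2 → ℂ,
      (∀ n : adelicUnipotent F E c 2,
        borelSumClass cl i ψ ((n : adelicUnipotent F E c 2) : (quasiSplit F E c 2).Adelic)
            ((n : adelicUnipotent F E c 2) : (quasiSplit F E c 2).Adelic) =
          ∑' p : {t : rationalTorus F E c 2 //
              cl ⟨((t : torusAdelic F E c 2) : (quasiSplit F E c 2).Adelic), t.2⟩ = i} × rationalUnipotent F E c 2,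
            Ψ p.1 (p.2 • n)) ∧
      (∀ t, Continuous (Ψ t)) ∧ (∀ t, Integrable (Ψ t) ν) ∧ (∑' t, ∫⁻ u, ‖Ψ t u‖ₑ ∂ν ≠ ⊤) ∧
      ∀ t, ∫ u, Ψ t u ∂ν = ∫ m : adelicUnipotent F E c 2,
          ψ ((((t : rationalTorus F E c 2) : torusAdelic F E c 2) : (quasiSplit F E c 2).Adelic) *
            ((m : adelicUnipotent F E c 2) : (quasiSplit F E c 2).Adelic)) ∂ν := by
  classical
  -- regularity of the torus points of the class
  have hregT : ∀ t : {t : rationalTorus F E c 2 //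
      cl ⟨((t : torusAdelic F E c 2) : (quasiSplit F E c 2).Adelic), t.2⟩ = i},
      diagUnit (torusAdelic_le_borelAdelic ((t : rationalTorus F E c 2) : torusAdelic F E c 2).2) 0 ≠
        diagUnit (torusAdelic_le_borelAdelic ((t : rationalTorus F E c 2) : torusAdelic F E c 2).2) 1 := fun t =>
    hreg ⟨⟨(((t : rationalTorus F E c 2) : torusAdelic F E c 2) : (quasiSplit F E c 2).Adelic), t.1.2⟩,
      (mem_arithmeticBorel_iff _).2 (torusAdelic_le_borelAdelic ((t : rationalTorus F E c 2) : torusAdelic F E c 2).2)⟩ t.2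
  -- the twist equivalences, class point by class point
  have htw : ∀ t : {t : rationalTorus F E c 2 //
      cl ⟨((t : torusAdelic F E c 2) : (quasiSplit F E c 2).Adelic), t.2⟩ = i},
      ∃ e : rationalUnipotent F E c 2 ≃ rationalUnipotent F E c 2, ∀ η : rationalUnipotent F E c 2,
        (((t : rationalTorus F E c 2) : torusAdelic F E c 2) : (quasiSplit F E c 2).Adelic) *
            ((e η : adelicUnipotent F E c 2) : (quasiSplit F E c 2).Adelic) =
          (((η : adelicUnipotent F E c 2) : (quasiSplit F E c 2).Adelic))⁻¹ *
            (((t : rationalTorus F E c 2) : torusAdelic F E c 2) : (quasiSplit F E c 2).Adelic) *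
            ((η : adelicUnipotent F E c 2) : (quasiSplit F E c 2).Adelic) := by
    intro t
    obtain ⟨g, τ, hg, hgmat, -, hτ⟩ := exists_rational_diagonal_of_rationalTorus_two (t : rationalTorus F E c 2)
    have h01 := ne_of_diagUnit_ne_two hτ (hregT t)
    exact exists_equiv_rationalUnipotent_twist_two hg hgmat h01
  choose e he using htw
  -- the fibre integrands `Ψ_t(u) = ψ(u⁻¹ t u)`
  set Ψ : {t : rationalTorus F E c 2 //
      cl ⟨((t : torusAdelic F E c 2) : (quasiSplit F E c 2).Adelic), t.2⟩ = i} →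
        adelicUnipotent F E c 2 → ℂ := fun t u =>
    ψ (((u : (quasiSplit F E c 2).Adelic))⁻¹ *
      (((t : rationalTorus F E c 2) : torusAdelic F E c 2) : (quasiSplit F E c 2).Adelic) *
      (u : (quasiSplit F E c 2).Adelic)) with hΨ
  -- pointwise: the class Borel sum at `(n, n)` is `Σ_{(t, η)} Ψ_t(η • n)`
  obtain ⟨ecell, hecell⟩ := exists_equiv_borelClassCell_prod hclN i
  have hpt : ∀ n : adelicUnipotent F E c 2,
      borelSumClass cl i ψ ((n : adelicUnipotent F E c 2) : (quasiSplit F E c 2).Adelic)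
          ((n : adelicUnipotent F E c 2) : (quasiSplit F E c 2).Adelic) =
        ∑' p : {t : rationalTorus F E c 2 //
            cl ⟨((t : torusAdelic F E c 2) : (quasiSplit F E c 2).Adelic), t.2⟩ = i} ×
              rationalUnipotent F E c 2, Ψ p.1 (p.2 • n) := by
    intro n
    rw [borelSumClass_def, ← ecell.symm.tsum_eq, ← (Equiv.prodCongrRight e).tsum_eq]
    refine tsum_congr fun p => ?_
    rw [Equiv.prodCongrRight_apply, hecell, he]
    simp only [hΨ, Subgroup.smul_def, smul_eq_mul, Subgroup.coe_mul, _root_.mul_inv_rev, mul_assoc]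
  -- continuity and integrability of each `Ψ_t` (through the Jacobian-one twist)
  have hΨc : ∀ t, Continuous (Ψ t) := fun t =>
    hψc.comp (((continuous_subtype_val.inv).mul continuous_const).mul continuous_subtype_val)
  have hΨi : ∀ t, Integrable (Ψ t) ν := by
    intro t
    have hcont : Continuous fun u : adelicUnipotent F E c 2 =>
        ψ ((((t : rationalTorus F E c 2) : torusAdelic F E c 2) : (quasiSplit F E c 2).Adelic) *
          (u : (quasiSplit F E c 2).Adelic)) :=
      hψc.comp (continuous_const.mul continuous_subtype_val)
    have hsupp : HasCompactSupport fun u : adelicUnipotent F E c 2 =>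
        ψ ((((t : rationalTorus F E c 2) : torusAdelic F E c 2) : (quasiSplit F E c 2).Adelic) *
          (u : (quasiSplit F E c 2).Adelic)) := by
      simpa only [mul_one] using hasCompactSupport_comp_mul_adelicUnipotent_mul hψ
        ((((t : rationalTorus F E c 2) : torusAdelic F E c 2) : (quasiSplit F E c 2).Adelic)) 1
    exact (integrable_adelicUnipotent_inv_mul_mul_iff_of_rationalTorus_two ν (t : rationalTorus F E c 2) (hregT t)
      ψ).2 (hcont.integrable_of_hasCompactSupport hsupp)
  -- only finitely many `t` meet the support: finite total mass
  have hS : {t : {t : rationalTorus F E c 2 //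
      cl ⟨((t : torusAdelic F E c 2) : (quasiSplit F E c 2).Adelic), t.2⟩ = i} |
        ∃ u : adelicUnipotent F E c 2, Ψ t u ≠ 0}.Finite := by
    have h0 := (finite_setOf_rationalTorus_meets_support hψ 1 1).preimage
      (f := (Subtype.val : {t : rationalTorus F E c 2 //
        cl ⟨((t : torusAdelic F E c 2) : (quasiSplit F E c 2).Adelic), t.2⟩ = i} → rationalTorus F E c 2))
      Subtype.val_injective.injOn
    refine h0.subset fun t ht => ?_
    obtain ⟨u, hu⟩ := ht
    refine ⟨⟨_, torus_inv_mul_inv_mul_mul_mem_adelicUnipotent_fin ((t : rationalTorus F E c 2) : torusAdelic F E c 2).2 u⟩, ?_⟩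
    rw [inv_one, one_mul, mul_one]
    have e : (((t : rationalTorus F E c 2) : torusAdelic F E c 2) : (quasiSplit F E c 2).Adelic) *
        ((((t : rationalTorus F E c 2) : torusAdelic F E c 2) : (quasiSplit F E c 2).Adelic)⁻¹ *
          ((u : (quasiSplit F E c 2).Adelic))⁻¹ *
          (((t : rationalTorus F E c 2) : torusAdelic F E c 2) : (quasiSplit F E c 2).Adelic) * (u : (quasiSplit F E c 2).Adelic)) =
        ((u : (quasiSplit F E c 2).Adelic))⁻¹ *
          (((t : rationalTorus F E c 2) : torusAdelic F E c 2) : (quasiSplit F E c 2).Adelic) * (u : (quasiSplit F E c 2).Adelic) := by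
      group
    rw [e]
    exact hu
  have hzero : ∀ t ∉ hS.toFinset, Ψ t = 0 := by
    intro t ht
    funext u
    by_contra h
    exact ht (hS.mem_toFinset.2 ⟨u, h⟩)
  have hfin : ∑' t, ∫⁻ u, ‖Ψ t u‖ₑ ∂ν ≠ ⊤ := by
    rw [tsum_eq_sum (s := hS.toFinset) (fun t ht => by rw [hzero t ht]; simp)]
    exact ENNReal.sum_ne_top.2 fun t _ => (hΨi t).2.ne
  exact ⟨Ψ, hpt, hΨc, hΨi, hfin, fun t =>
    integral_adelicUnipotent_inv_mul_mul_eq_of_rationalTorus_two hc hc1 ν (t : rationalTorus F E c 2) (hregT t) ψ⟩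

/-- Instances for the left translation action of `N(F)` on `N(𝔸_F)` (private plumbing): measurable, measure
preserving for a Haar measure. [folklore] -/
private theorem smul_instances (ν : Measure (adelicUnipotent F E c 2)) [ν.IsHaarMeasure] :
    MeasurableConstSMul (rationalUnipotent F E c 2) (adelicUnipotent F E c 2) ∧
      SMulInvariantMeasure (rationalUnipotent F E c 2) (adelicUnipotent F E c 2) ν := by
  haveI : MeasurableConstSMul (rationalUnipotent F E c 2) (adelicUnipotent F E c 2) :=
    ⟨fun γ => (continuous_const.mul continuous_id).measurable⟩
  exact ⟨inferInstance, ⟨fun γ s _hs => by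
    rw [show (fun u : adelicUnipotent F E c 2 => γ • u) ⁻¹' s =
        (fun u : adelicUnipotent F E c 2 => ((γ : adelicUnipotent F E c 2)) * u) ⁻¹' s from rfl,
      measure_preimage_mul]⟩⟩

/-- **`∫_{N(F)\N(𝔸)} Σ_{β ∈ B(F)∩𝔬̲} ψ(n⁻¹βn) dn = Σ_{t ∈ T(F)∩𝔬̲} ∫_{N(𝔸)} ψ(t u) du` FOR AN `N`-REGULAR CLASS.**  For
`U(J₂)` of a quadratic `E/F` (`c² = 1`, `c ≠ 1`), a class map `cl` on `G(F)` constant along `N(F)` on `B(F)`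
(★ `IsUnipotentInvariantOnBorel`), a class `𝔬 = i` ALL of whose rational Borel points have `N`-regular diagonal
(`hreg`), a Haar measure `ν` of `N(𝔸_F)`, a fundamental domain `Ω` of `N(F)` in `N(𝔸_F)` and `ψ ∈ C_c(G(𝔸_F))`:
`∫_Ω Σ_{β ∈ B(F), cl β = i} ψ(n⁻¹ β n) dν(n) = Σ'_{t ∈ T(F), cl t = i} ∫_{N(𝔸_F)} ψ(t u) dν(u)` — the cell
`{β} ≃ {t} × N(F)` (★ `exists_equiv_borelClassCell_prod`), for each `t` the reparametrisation `t n₀ = η⁻¹ t η` of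
`tN(F)` by `η ∈ N(F)` (§2), so that the summand is `Ψ_t(η n)` with `Ψ_t(u) = ψ(u⁻¹ t u)`; then the unfolding
`∫_Ω Σ_{(t,η)} Ψ_t(η n) = Σ_t ∫_{N(𝔸)} Ψ_t` (★ `setIntegral_tsum_prod_smul_eq_tsum_integral`; only finitely many `t`
meet the support, ★ `finite_setOf_rationalTorus_meets_support`) and the Jacobian-one change of variables (§3).
(Arthur (1978) §8; Rogawski (1990) §7.3 p. 97.) [cite: Arthur1978TraceFormulaI, §8] [cite: Rogawski1990, §2.2 (p. 13); §7.3 (p. 97)] -/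
theorem setIntegral_borelSumClass_diag_eq_tsum_integral_two (hc : c * c = 1) (hc1 : c ≠ 1)
    {cl : (quasiSplit F E c 2).arithmeticSubgroup → ι} (hclN : IsUnipotentInvariantOnBorel F E c 2 cl) (i : ι)
    (hreg : ∀ β : arithmeticBorel F E c 2, cl β = i →
      diagUnit ((mem_arithmeticBorel_iff _).1 β.2) 0 ≠ diagUnit ((mem_arithmeticBorel_iff _).1 β.2) 1)
    (ν : Measure (adelicUnipotent F E c 2)) [ν.IsHaarMeasure]
    {Ω : Set (adelicUnipotent F E c 2)} (hΩ : IsFundamentalDomain (rationalUnipotent F E c 2) Ω ν)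
    {ψ : (quasiSplit F E c 2).Adelic → ℂ} (hψc : Continuous ψ) (hψ : HasCompactSupport ψ) :
    ∫ n in Ω, borelSumClass cl i ψ ((n : adelicUnipotent F E c 2) : (quasiSplit F E c 2).Adelic)
        ((n : adelicUnipotent F E c 2) : (quasiSplit F E c 2).Adelic) ∂ν =
      ∑' t : {t : rationalTorus F E c 2 //
          cl ⟨((t : torusAdelic F E c 2) : (quasiSplit F E c 2).Adelic), t.2⟩ = i},
        ∫ m : adelicUnipotent F E c 2,
          ψ ((((t : rationalTorus F E c 2) : torusAdelic F E c 2) : (quasiSplit F E c 2).Adelic) *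
            ((m : adelicUnipotent F E c 2) : (quasiSplit F E c 2).Adelic)) ∂ν := by
  obtain ⟨hcN, hcT⟩ := countable_rationalUnipotent_rationalTorus₂₃w (F := F) (E := E) (c := c) (N := 2)
  haveI := hcN
  haveI := hcT
  obtain ⟨hI1, hI2⟩ := smul_instances (F := F) (E := E) (c := c) ν
  haveI := hI1
  haveI := hI2
  obtain ⟨Ψ, hpt, -, hΨi, hfin, hint⟩ := exists_latticeSum_fibration hc hc1 hclN i hreg ν hψc hψ
  simp_rw [hpt]
  rw [setIntegral_tsum_prod_smul_eq_tsum_integral hΩ hΨi hfin]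
  exact tsum_congr hint

/-- **The class Borel lattice sum on the diagonal is integrable on a fundamental domain of `N(F)`** (`N`-regular
class, `ψ ∈ C_c`): `∫_Ω |Σ_{(t,η)} Ψ_t(ηn)| ≤ Σ_t ∫_{N(𝔸)} |Ψ_t| < ∞` (same fibration; Mathlib `lintegral_tsum`,
`IsFundamentalDomain.lintegral_eq_tsum''`). [cite: Arthur1978TraceFormulaI, §8] [cite: Rogawski1990, §2.2 (p. 13)] -/
theorem integrableOn_borelSumClass_diag_two (hc : c * c = 1) (hc1 : c ≠ 1)
    {cl : (quasiSplit F E c 2).arithmeticSubgroup → ι} (hclN : IsUnipotentInvariantOnBorel F E c 2 cl) (i : ι)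
    (hreg : ∀ β : arithmeticBorel F E c 2, cl β = i →
      diagUnit ((mem_arithmeticBorel_iff _).1 β.2) 0 ≠ diagUnit ((mem_arithmeticBorel_iff _).1 β.2) 1)
    (ν : Measure (adelicUnipotent F E c 2)) [ν.IsHaarMeasure]
    {Ω : Set (adelicUnipotent F E c 2)} (hΩ : IsFundamentalDomain (rationalUnipotent F E c 2) Ω ν)
    {ψ : (quasiSplit F E c 2).Adelic → ℂ} (hψc : Continuous ψ) (hψ : HasCompactSupport ψ) :
    IntegrableOn (fun n : adelicUnipotent F E c 2 =>
      borelSumClass cl i ψ ((n : adelicUnipotent F E c 2) : (quasiSplit F E c 2).Adelic)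
        ((n : adelicUnipotent F E c 2) : (quasiSplit F E c 2).Adelic)) Ω ν := by
  obtain ⟨hcN, hcT⟩ := countable_rationalUnipotent_rationalTorus₂₃w (F := F) (E := E) (c := c) (N := 2)
  haveI := hcN
  haveI := hcT
  obtain ⟨hI1, hI2⟩ := smul_instances (F := F) (E := E) (c := c) ν
  haveI := hI1
  haveI := hI2
  obtain ⟨Ψ, hpt, hΨc, hΨi, hfin, -⟩ := exists_latticeSum_fibration hc hc1 hclN i hreg ν hψc hψ
  have heq : (fun n : adelicUnipotent F E c 2 =>
      borelSumClass cl i ψ ((n : adelicUnipotent F E c 2) : (quasiSplit F E c 2).Adelic)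
        ((n : adelicUnipotent F E c 2) : (quasiSplit F E c 2).Adelic)) =
      fun n => ∑' p : {t : rationalTorus F E c 2 //
          cl ⟨((t : torusAdelic F E c 2) : (quasiSplit F E c 2).Adelic), t.2⟩ = i} × rationalUnipotent F E c 2,
        Ψ p.1 (p.2 • n) := funext hpt
  rw [heq]
  -- the translates are measurable
  have hmeas : ∀ p : {t : rationalTorus F E c 2 //
      cl ⟨((t : torusAdelic F E c 2) : (quasiSplit F E c 2).Adelic), t.2⟩ = i} × rationalUnipotent F E c 2,
      Measurable fun n : adelicUnipotent F E c 2 => Ψ p.1 (p.2 • n) := fun p =>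
    (hΨc p.1).measurable.comp (measurable_const_smul p.2)
  refine ⟨(Measurable.tsum hmeas).aestronglyMeasurable, ?_⟩
  -- finite integral: `∫⁻_Ω ‖Σ‖ₑ ≤ Σ ∫⁻_Ω ‖·‖ₑ = Σ_t ∫⁻ ‖Ψ_t‖ₑ < ∞`
  have hlin : ∑' p : {t : rationalTorus F E c 2 //
      cl ⟨((t : torusAdelic F E c 2) : (quasiSplit F E c 2).Adelic), t.2⟩ = i} × rationalUnipotent F E c 2,
        ∫⁻ n in Ω, ‖Ψ p.1 (p.2 • n)‖ₑ ∂ν = ∑' t, ∫⁻ u, ‖Ψ t u‖ₑ ∂ν := by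
    rw [ENNReal.tsum_prod']
    exact tsum_congr fun t => (hΩ.lintegral_eq_tsum'' (fun u => ‖Ψ t u‖ₑ)).symm
  refine lt_of_le_of_lt ?_ (lt_top_iff_ne_top.2 (hlin ▸ hfin))
  calc ∫⁻ n in Ω, ‖∑' p : {t : rationalTorus F E c 2 //
          cl ⟨((t : torusAdelic F E c 2) : (quasiSplit F E c 2).Adelic), t.2⟩ = i} × rationalUnipotent F E c 2,
            Ψ p.1 (p.2 • n)‖ₑ ∂ν
      ≤ ∫⁻ n in Ω, ∑' p : {t : rationalTorus F E c 2 //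
          cl ⟨((t : torusAdelic F E c 2) : (quasiSplit F E c 2).Adelic), t.2⟩ = i} × rationalUnipotent F E c 2,
            ‖Ψ p.1 (p.2 • n)‖ₑ ∂ν := lintegral_mono fun n => enorm_tsum_le_tsum_enorm
    _ = ∑' p : {t : rationalTorus F E c 2 //
          cl ⟨((t : torusAdelic F E c 2) : (quasiSplit F E c 2).Adelic), t.2⟩ = i} × rationalUnipotent F E c 2,
            ∫⁻ n in Ω, ‖Ψ p.1 (p.2 • n)‖ₑ ∂ν :=
        lintegral_tsum fun p => (hmeas p).enorm.aemeasurable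

end Unfold

/-! ## §5 The `N(F)\N(𝔸_F)`-average of `D_𝔬 = K_{B,𝔬} − Σ_{B(F)∩𝔬̲}` VANISHES (for an `N`-regular class) -/

section Vanishing

variable [MeasurableSpace (adelicUnipotent F E c 2)] [BorelSpace (adelicUnipotent F E c 2)]

omit [MeasurableSpace (adelicUnipotent F E c 2)] [BorelSpace (adelicUnipotent F E c 2)] in
/-- The idèlic diagonal of a unipotent element is `1`, so `δ_B(n) = 1` on `N(𝔸_F)`. [cite: Rogawski1990, §1.10] -/
theorem torusRootModulus_diagUnit_eq_one_of_mem_adelicUnipotent_two {n : (quasiSplit F E c 2).Adelic}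
    (hn : n ∈ adelicUnipotent F E c 2) :
    torusRootModulus E 2 (diagUnit (adelicUnipotent_le_borelAdelic hn)) = 1 := by
  have h1 : diagUnit (adelicUnipotent_le_borelAdelic hn) = 1 := by
    have h := diagUnit_eq_diagUnit_torusPart (⟨n, adelicUnipotent_le_borelAdelic hn⟩ : borelAdelic F E c 2)
    rw [torusPart_eq_one_of_mem (u := ⟨n, adelicUnipotent_le_borelAdelic hn⟩) hn] at h
    rw [show diagUnit (adelicUnipotent_le_borelAdelic hn) =
      diagUnit (⟨n, adelicUnipotent_le_borelAdelic hn⟩ : borelAdelic F E c 2).2 from rfl, h]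
    funext j
    refine Units.ext ?_
    rw [coe_diagUnit, OneMemClass.coe_one, map_one, Units.val_one, Matrix.one_apply_eq, Pi.one_apply, Units.val_one]
  rw [h1, torusRootModulus_one]

/-- **The diagonal of the class Borel kernel is constant along `N(𝔸_F)`**: `K_{B,𝔬}(n, n) = K_{B,𝔬}(1, 1)` for
`n ∈ N(𝔸_F)` (★ `kernelBorelClass_diag_borel_mul_two` with `δ_B(n) = 1`). [cite: Rogawski1990, §2.2 (p. 13)] -/
theorem kernelBorelClass_diag_unipotent_eq_two {cl : (quasiSplit F E c 2).arithmeticSubgroup → ι}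
    (hc : c * c = 1) (hc1 : c ≠ 1) (ν : Measure (adelicUnipotent F E c 2)) [ν.IsHaarMeasure]
    {𝓕 : Set (adelicUnipotent F E c 2)} (h𝓕 : IsFundamentalDomain (rationalUnipotent F E c 2) 𝓕 ν)
    (hclN : IsUnipotentInvariantOnBorel F E c 2 cl) {f : (quasiSplit F E c 2).Adelic → ℂ} (hfc : Continuous f)
    (hf : HasCompactSupport f) (n : adelicUnipotent F E c 2) (i : ι) :
    kernelBorelClass ν 𝓕 cl i f ((n : adelicUnipotent F E c 2) : (quasiSplit F E c 2).Adelic)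
        ((n : adelicUnipotent F E c 2) : (quasiSplit F E c 2).Adelic) =
      kernelBorelClass ν 𝓕 cl i f 1 1 := by
  haveI : LocallyCompactSpace (AdeleRing (𝓞 E) E) := locallyCompactSpace_adeleRing' E
  letI : MeasurableSpace (AdeleRing (𝓞 E) E) := borel _
  haveI : BorelSpace (AdeleRing (𝓞 E) E) := ⟨rfl⟩
  have h := kernelBorelClass_diag_borel_mul_two hc hc1 ν h𝓕 hclN hfc hf
    ⟨((n : adelicUnipotent F E c 2) : (quasiSplit F E c 2).Adelic), adelicUnipotent_le_borelAdelic n.2⟩ 1 i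
  rw [mul_one] at h
  rw [h, torusRootModulus_diagUnit_eq_one_of_mem_adelicUnipotent_two n.2, NNReal.coe_one, one_smul]

/-- **THE `N(F)\N(𝔸_F)`-AVERAGE OF `D_𝔬` VANISHES FOR AN `N`-REGULAR CLASS**: for `U(J₂)` of a quadratic `E/F`, a
class map `cl` constant along `N(F)` on `B(F)` with class `𝔬 = i` all of whose rational Borel points have
`N`-regular diagonal (`hreg`), a Haar measure `ν` of `N(𝔸_F)`, fundamental domains `𝓕` (in the definition of
`K_{B,𝔬}`) and `Ω` of `N(F)` with `ν(Ω) < ∞`, and `ψ ∈ C_c(G(𝔸_F))`: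
`∫_Ω (K_{B,𝔬}(n, n) − Σ_{β ∈ B(F), cl β = i} ψ(n⁻¹βn)) dν(n) = 0` — `K_{B,𝔬}(n,n) = K_{B,𝔬}(1,1) =
ν(𝓕)⁻¹ Σ_t ∫_{N(𝔸)} ψ(t m) dm` (★ `kernelBorelClass_diag_eq_smul_tsum_integral`), `ν(Ω) = ν(𝓕)` (Mathlib
`IsFundamentalDomain.measure_eq`), and §4. Without `hreg` this FAILS (central class: the orbit `n₀ = 1` alone gives
`ν(Ω) ψ(z)` against `∫_{N(𝔸)} ψ(zu) du` — [Rogawski1990, Prop. 7.3.2]).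
[cite: Arthur1978TraceFormulaI, §8] [cite: Rogawski1990, §2.2 (p. 13); §7.3 (p. 97)] -/
theorem setIntegral_kernelBorelClass_diag_sub_borelSumClass_diag_eq_zero_two (hc : c * c = 1) (hc1 : c ≠ 1)
    {cl : (quasiSplit F E c 2).arithmeticSubgroup → ι} (hclN : IsUnipotentInvariantOnBorel F E c 2 cl) (i : ι)
    (hreg : ∀ β : arithmeticBorel F E c 2, cl β = i →
      diagUnit ((mem_arithmeticBorel_iff _).1 β.2) 0 ≠ diagUnit ((mem_arithmeticBorel_iff _).1 β.2) 1)
    (ν : Measure (adelicUnipotent F E c 2)) [ν.IsHaarMeasure]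
    {𝓕 : Set (adelicUnipotent F E c 2)} (h𝓕 : IsFundamentalDomain (rationalUnipotent F E c 2) 𝓕 ν)
    {Ω : Set (adelicUnipotent F E c 2)} (hΩ : IsFundamentalDomain (rationalUnipotent F E c 2) Ω ν) (hΩtop : ν Ω ≠ ⊤)
    {ψ : (quasiSplit F E c 2).Adelic → ℂ} (hψc : Continuous ψ) (hψ : HasCompactSupport ψ) :
    ∫ n in Ω, (kernelBorelClass ν 𝓕 cl i ψ ((n : adelicUnipotent F E c 2) : (quasiSplit F E c 2).Adelic)
          ((n : adelicUnipotent F E c 2) : (quasiSplit F E c 2).Adelic) -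
        borelSumClass cl i ψ ((n : adelicUnipotent F E c 2) : (quasiSplit F E c 2).Adelic)
          ((n : adelicUnipotent F E c 2) : (quasiSplit F E c 2).Adelic)) ∂ν = 0 := by
  obtain ⟨hcN, hcT⟩ := countable_rationalUnipotent_rationalTorus₂₃w (F := F) (E := E) (c := c) (N := 2)
  haveI := hcN
  haveI := hcT
  obtain ⟨hI1, hI2⟩ := smul_instances (F := F) (E := E) (c := c) ν
  haveI := hI1
  haveI := hI2
  -- the `K_{B,𝔬}`-term is the constant `K_{B,𝔬}(1,1)` on `N(𝔸_F)`
  have hK : ∀ n : adelicUnipotent F E c 2,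
      kernelBorelClass ν 𝓕 cl i ψ ((n : adelicUnipotent F E c 2) : (quasiSplit F E c 2).Adelic)
        ((n : adelicUnipotent F E c 2) : (quasiSplit F E c 2).Adelic) = kernelBorelClass ν 𝓕 cl i ψ 1 1 := fun n =>
    kernelBorelClass_diag_unipotent_eq_two hc hc1 ν h𝓕 hclN hψc hψ n i
  have hKi : IntegrableOn (fun n : adelicUnipotent F E c 2 =>
      kernelBorelClass ν 𝓕 cl i ψ ((n : adelicUnipotent F E c 2) : (quasiSplit F E c 2).Adelic)
        ((n : adelicUnipotent F E c 2) : (quasiSplit F E c 2).Adelic)) Ω ν := by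
    simp_rw [hK]
    exact integrableOn_const hΩtop
  rw [integral_sub hKi (integrableOn_borelSumClass_diag_two hc hc1 hclN i hreg ν hΩ hψc hψ),
    setIntegral_borelSumClass_diag_eq_tsum_integral_two hc hc1 hclN i hreg ν hΩ hψc hψ, sub_eq_zero]
  simp_rw [hK]
  rw [setIntegral_const, measureReal_def, kernelBorelClass_diag_eq_smul_tsum_integral ν h𝓕 hclN hψc hψ 1 i,
    hΩ.measure_eq h𝓕, smul_smul]
  -- `ν(𝓕) · ν(𝓕)⁻¹ = 1` (`0 < ν(𝓕) < ∞`)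
  have h𝓕top : ν 𝓕 ≠ ⊤ := by rw [← hΩ.measure_eq h𝓕]; exact hΩtop
  have h𝓕0 : ν 𝓕 ≠ 0 := by
    intro h0
    have huniv : ν Set.univ = 0 := by
      rw [h𝓕.measure_eq_tsum' Set.univ]
      simp [measure_smul, h0]
    exact IsOpenPosMeasure.open_pos (μ := ν) _ isOpen_univ Set.univ_nonempty huniv
  rw [mul_inv_cancel₀ (ENNReal.toReal_ne_zero.2 ⟨h𝓕0, h𝓕top⟩), one_smul]
  refine tsum_congr fun t => ?_
  simp only [inv_one, one_mul, mul_one]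

/-- **THE TRANSLATED FORM — `∫_Ω D_𝔬(n g₀) dν(n) = 0` for every `g₀ ∈ G(𝔸_F)`** (the input of (W2-b) FILE 3 after
unfolding and Iwasawa coordinates `g₀ = t k`): `D^f_𝔬(n g₀) = D^{ψ}_𝔬(n)` pointwise with `ψ = f(g₀⁻¹ · g₀) ∈ C_c`
(both `K_{B,𝔬}` and the lattice sum are built from `y⁻¹ (·) y`), then the previous theorem.
[cite: Arthur1978TraceFormulaI, §8] [cite: Rogawski1990, §2.2 (p. 13); §6.1 (pp. 79–81)] -/
theorem setIntegral_kernelBorelClass_sub_borelSumClass_translate_eq_zero_two (hc : c * c = 1) (hc1 : c ≠ 1)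
    {cl : (quasiSplit F E c 2).arithmeticSubgroup → ι} (hclN : IsUnipotentInvariantOnBorel F E c 2 cl) (i : ι)
    (hreg : ∀ β : arithmeticBorel F E c 2, cl β = i →
      diagUnit ((mem_arithmeticBorel_iff _).1 β.2) 0 ≠ diagUnit ((mem_arithmeticBorel_iff _).1 β.2) 1)
    (ν : Measure (adelicUnipotent F E c 2)) [ν.IsHaarMeasure]
    {𝓕 : Set (adelicUnipotent F E c 2)} (h𝓕 : IsFundamentalDomain (rationalUnipotent F E c 2) 𝓕 ν)
    {Ω : Set (adelicUnipotent F E c 2)} (hΩ : IsFundamentalDomain (rationalUnipotent F E c 2) Ω ν) (hΩtop : ν Ω ≠ ⊤)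
    {f : (quasiSplit F E c 2).Adelic → ℂ} (hfc : Continuous f) (hf : HasCompactSupport f)
    (g₀ : (quasiSplit F E c 2).Adelic) :
    ∫ n in Ω, (kernelBorelClass ν 𝓕 cl i f (((n : adelicUnipotent F E c 2) : (quasiSplit F E c 2).Adelic) * g₀)
          (((n : adelicUnipotent F E c 2) : (quasiSplit F E c 2).Adelic) * g₀) -
        borelSumClass cl i f (((n : adelicUnipotent F E c 2) : (quasiSplit F E c 2).Adelic) * g₀)
          (((n : adelicUnipotent F E c 2) : (quasiSplit F E c 2).Adelic) * g₀)) ∂ν = 0 := by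
  -- the conjugated test function `ψ = f(g₀⁻¹ · g₀)`
  set ψ : (quasiSplit F E c 2).Adelic → ℂ := fun h => f (g₀⁻¹ * h * g₀) with hψ
  have hψc : Continuous ψ := hfc.comp ((continuous_const.mul continuous_id).mul continuous_const)
  have hψs : HasCompactSupport ψ :=
    hf.comp_isClosedEmbedding ((Homeomorph.mulLeft g₀⁻¹).trans (Homeomorph.mulRight g₀)).isClosedEmbedding
  -- pointwise `D^f(n g₀) = D^ψ(n)`
  have hS : ∀ y u : (quasiSplit F E c 2).Adelic,
      borelSumClass cl i f (y * g₀) (u * (y * g₀)) = borelSumClass cl i ψ y (u * y) := by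
    intro y u
    rw [borelSumClass_def, borelSumClass_def]
    refine tsum_congr fun β => ?_
    simp only [hψ, _root_.mul_inv_rev, mul_assoc]
  have hpt : ∀ n : adelicUnipotent F E c 2,
      kernelBorelClass ν 𝓕 cl i f (((n : adelicUnipotent F E c 2) : (quasiSplit F E c 2).Adelic) * g₀)
          (((n : adelicUnipotent F E c 2) : (quasiSplit F E c 2).Adelic) * g₀) -
        borelSumClass cl i f (((n : adelicUnipotent F E c 2) : (quasiSplit F E c 2).Adelic) * g₀)
          (((n : adelicUnipotent F E c 2) : (quasiSplit F E c 2).Adelic) * g₀) =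
      kernelBorelClass ν 𝓕 cl i ψ ((n : adelicUnipotent F E c 2) : (quasiSplit F E c 2).Adelic)
          ((n : adelicUnipotent F E c 2) : (quasiSplit F E c 2).Adelic) -
        borelSumClass cl i ψ ((n : adelicUnipotent F E c 2) : (quasiSplit F E c 2).Adelic)
          ((n : adelicUnipotent F E c 2) : (quasiSplit F E c 2).Adelic) := by
    intro n
    have h1 := hS ((n : adelicUnipotent F E c 2) : (quasiSplit F E c 2).Adelic) 1
    rw [one_mul, one_mul] at h1
    rw [h1, kernelBorelClass_def, kernelBorelClass_def, borelConstantTerm_def, borelConstantTerm_def]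
    simp_rw [hS]
  simp_rw [hpt]
  exact setIntegral_kernelBorelClass_diag_sub_borelSumClass_diag_eq_zero_two hc hc1 hclN i hreg ν h𝓕 hΩ hΩtop hψc hψs

end Vanishing

end UnitaryGroup

end Literature.NumberTheory.Automorphic

end
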